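import Literature.Analysis.SegalBargmann.FockRotationCoefficients
import Literature.Analysis.SegalBargmann.SchwartzUnitaryIdentification
import Literature.NumberTheory.Weil1964.ArchPlaceCompactSliceCharacter
import HarnessLib

/-!
# The Hermite-basis matrix `uKernel` of the compact metaplectic action IS the Bargmann substitution coefficient; the two
# non-zero coefficients of the rational mixing at one place ([Folland1989, Prop. (4.39), Ch. 4 §5])

Topic `NumberTheory/Weil1964` (§2 places) with §1 in namespace `Literature.Analysis.SegalBargmann`; KERNEL ONLY: theorems; no definition, no
named fact, no `sorry`.

* §1 **`uKernel_eq_coeff_linSubst_zeta`**: `uKernel U γ β = ⟪h_γ, μ₀(U) h_β⟫ = coeff_γ (ζ_β ∘ U⁻¹) · (hcoef γ)⁻¹` — through the Bargmann unitary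
  (★ `schrodingerU_apply`, ★ `bargmann_hermiteL2`) the compact action is `F ↦ F ∘ U⁻¹` on the Fock polynomials (★ `fockRep_fockToL2`), whose
  `ζ`-expansion is ★ `fockToL2_eq_sum`; hence `uKernel U γ β ≠ 0 ↔ coeff γ (linSubst (star U) ζ_β) ≠ 0`.
* §2 at ONE place `v` of a several-places index `κ × o`, for the rational mixing `mixU` of two coordinates `k ≠ k′` of `v` (★ `FockInvariantLines.mixU`,
  `(3 z_k + 4 z_{k′})∕5`, self-adjoint ★ `star_mixU`), embedded as ★ `placeBlock (Pi.mulSingle v ·)`: the MERGE coefficient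
  `uKernel (mixU at v) (merge β) β ≠ 0` (★ `FockPkIrreducible.coeff_merge_linSubst_mixM_zeta_ne_zero`) and the UN-MERGE coefficient
  `uKernel (mixU at v) γ (merge γ) ≠ 0` (★ `FockRotationCoefficients.coeff_linSubst_mixM_zeta_merge_ne_zero`), `merge = merge (k,v) (k′,v)`.
  Two Folland–Hermite indices with the same exponents off `{(k,v), (k′,v)}` and the same `(k,v)+(k′,v)`-degree have the same merge (★ `merge_eq_merge`),
  so they are linked by TWO compact steps with non-zero target Hermite coefficient — the polynomial half of the definite-place transitivity of the
  archimedean ladder (line LD1 of crux HLiu418, brick (Gα-C∞), plate (P2)).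

## References
* [Folland1989] G. B. Folland, *Harmonic Analysis in Phase Space* (1989), §1.7, Prop. (4.39), Ch. 4 §5 (before Prop. (4.76)).
-/

set_option autoImplicit false

noncomputable section

open MeasureTheory Complex MvPolynomial Matrix
open scoped InnerProductSpace ComplexConjugate

/-! ## §1 `uKernel` is the Bargmann substitution coefficient -/

namespace Literature.Analysis.SegalBargmann

variable {σ : Type*} [Fintype σ] [DecidableEq σ]

/-- **`uKernel U γ β = coeff γ (linSubst (star U) ζ_β) · (hcoef γ)⁻¹`**: the Hermite-basis matrix of `μ₀(U)` is read in the Fock model, where `U`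
acts by the substitution `F ↦ F ∘ U⁻¹` and `B⁻¹(c z^γ) = (c ∕ hcoef γ) ζ_γ`. [cite: Folland1989, Prop. (4.39)] -/
theorem uKernel_eq_coeff_linSubst_zeta (U : Matrix.unitaryGroup σ ℂ) (γ β : σ →₀ ℕ) :
    uKernel U γ β = coeff γ (linSubst (star (U : Matrix σ σ ℂ)) (zeta β)) * ((((hcoef γ : ℝ) : ℂ)))⁻¹ := by
  have hγ : (hermiteL2 γ : Lp ℂ 2 (volume : Measure (σ → ℝ))) = bargmann.symm (fockVec γ) := by
    rw [← bargmann_hermiteL2, LinearIsometryEquiv.symm_apply_apply]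
  rw [uKernel, schrodingerU_apply, bargmann_hermiteL2, hγ, LinearIsometryEquiv.inner_map_map, ← fockToL2_zeta β, fockRep_fockToL2,
    fockToL2_eq_sum, inner_sum, ← fockBasis_apply]
  by_cases hmem : γ ∈ (linSubst (star (U : Matrix σ σ ℂ)) (zeta β)).support
  · rw [Finset.sum_eq_single_of_mem γ hmem]
    · exact (inner_smul_right (𝕜 := ℂ) (fockBasis γ : FockL2 σ) (fockBasis γ : FockL2 σ) _).trans
        (by rw [orthonormal_iff_ite.mp fockBasis.orthonormal, if_pos rfl, mul_one])
    · intro α _ hαγ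
      exact (inner_smul_right (𝕜 := ℂ) (fockBasis γ : FockL2 σ) (fockBasis α : FockL2 σ) _).trans
        (by rw [orthonormal_iff_ite.mp fockBasis.orthonormal, if_neg (Ne.symm hαγ), mul_zero])
  · rw [MvPolynomial.notMem_support_iff.mp hmem, zero_mul]
    refine Finset.sum_eq_zero fun α hα => ?_
    exact (inner_smul_right (𝕜 := ℂ) (fockBasis γ : FockL2 σ) (fockBasis α : FockL2 σ) _).trans
      (by rw [orthonormal_iff_ite.mp fockBasis.orthonormal, if_neg (fun h : γ = α => hmem (by rw [h]; exact hα)), mul_zero])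

/-- `uKernel U γ β ≠ 0 ↔ coeff γ (linSubst (star U) ζ_β) ≠ 0`. [cite: Folland1989, Prop. (4.39)] -/
theorem uKernel_ne_zero_iff (U : Matrix.unitaryGroup σ ℂ) (γ β : σ →₀ ℕ) :
    uKernel U γ β ≠ 0 ↔ coeff γ (linSubst (star (U : Matrix σ σ ℂ)) (zeta β)) ≠ 0 := by
  rw [uKernel_eq_coeff_linSubst_zeta, mul_ne_zero_iff]
  exact ⟨fun h => h.1, fun h => ⟨h, inv_ne_zero (Complex.ofReal_ne_zero.mpr (hcoef_pos γ).ne')⟩⟩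

end Literature.Analysis.SegalBargmann

/-! ## §2 The two non-zero coefficients of the rational mixing at one place -/

namespace Literature.NumberTheory.Weil1964

open Literature.Analysis.SegalBargmann

variable {κ : Type} [Fintype κ] [DecidableEq κ] {o : Type} [Fintype o] [DecidableEq o]

/-- the Bargmann substitution matrix of the mixing at the place `v`: `star (mixU at v) = mixM (k,v) (k′,v)` on `κ × o`.
[cite: Folland1989, Ch. 4 §5 (before Prop. (4.76))] -/
theorem star_coe_placeBlock_mulSingle_mixU (v : o) {k k' : κ} (hkk' : k ≠ k') :
    star ((placeBlock (Pi.mulSingle v (mixU hkk')) : Matrix.unitaryGroup (κ × o) ℂ) : Matrix (κ × o) (κ × o) ℂ) =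
      mixM ((k, v) : κ × o) (k', v) := by
  rw [star_coe_placeBlock_mulSingle, coe_mixU, star_mixM hkk', blockDiagonal_mulSingle_mixM v hkk']

/-- **MERGE at the place `v`**: `uKernel (mixU at v) (merge (k,v) (k′,v) β) β ≠ 0`. [cite: Folland1989, Ch. 4 §5 (before Prop. (4.76))] -/
theorem uKernel_placeBlock_mixU_merge_ne_zero (v : o) {k k' : κ} (hkk' : k ≠ k') (β : (κ × o) →₀ ℕ) :
    uKernel (placeBlock (Pi.mulSingle v (mixU hkk'))) (merge ((k, v) : κ × o) (k', v) β) β ≠ 0 := by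
  rw [uKernel_ne_zero_iff, star_coe_placeBlock_mulSingle_mixU v hkk']
  exact coeff_merge_linSubst_mixM_zeta_ne_zero (fun h => hkk' (Prod.ext_iff.mp h).1) β

/-- **UN-MERGE at the place `v`**: `uKernel (mixU at v) γ (merge (k,v) (k′,v) γ) ≠ 0`. [cite: Folland1989, Ch. 4 §5 (before Prop. (4.76))] -/
theorem uKernel_placeBlock_mixU_of_merge_ne_zero (v : o) {k k' : κ} (hkk' : k ≠ k') (γ : (κ × o) →₀ ℕ) :
    uKernel (placeBlock (Pi.mulSingle v (mixU hkk'))) γ (merge ((k, v) : κ × o) (k', v) γ) ≠ 0 := by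
  rw [uKernel_ne_zero_iff, star_coe_placeBlock_mulSingle_mixU v hkk']
  exact coeff_linSubst_mixM_zeta_merge_ne_zero (fun h => hkk' (Prod.ext_iff.mp h).1) γ

/-- **two indices with the same merge are linked through it**: if `β, γ : κ × o →₀ ℕ` have the same exponents off the two `v`-coordinates `(k,v), (k′,v)`
and the same `(k,v)+(k′,v)`-degree, then with `m := merge (k,v) (k′,v) β = merge (k,v) (k′,v) γ` both `uKernel (mixU at v) m β ≠ 0` and
`uKernel (mixU at v) γ m ≠ 0`. [cite: Folland1989, Ch. 4 §5 (before Prop. (4.76))] -/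
theorem uKernel_placeBlock_mixU_merge_ne_zero_and (v : o) {k k' : κ} (hkk' : k ≠ k') (β γ : (κ × o) →₀ ℕ)
    (hsum : β (k, v) + β (k', v) = γ (k, v) + γ (k', v)) (hrest : ∀ l, l ≠ ((k, v) : κ × o) → l ≠ (k', v) → β l = γ l) :
    uKernel (placeBlock (Pi.mulSingle v (mixU hkk'))) (merge ((k, v) : κ × o) (k', v) β) β ≠ 0 ∧
      uKernel (placeBlock (Pi.mulSingle v (mixU hkk'))) γ (merge ((k, v) : κ × o) (k', v) β) ≠ 0 := by
  refine ⟨uKernel_placeBlock_mixU_merge_ne_zero v hkk' β, ?_⟩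
  rw [merge_eq_merge (fun h => hkk' (Prod.ext_iff.mp h).1) hsum hrest]
  exact uKernel_placeBlock_mixU_of_merge_ne_zero v hkk' γ

end Literature.NumberTheory.Weil1964

end
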